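import Literature.Combinatorics.SimpleGraph.LaplacianVertexDeletion
import HarnessLib

/-!
# The algebraic connectivity of a tree is at most `1` (Merris 2000, Ch. 9 Exercise 9)

Layer `Literature/Combinatorics/SimpleGraph`, namespace
`Literature.Combinatorics.SimpleGraph.TreeAlgebraicConnectivity` (lane `lit-hodgefound`, prover
seat `lit-hodgefound-p23`, row «A4-17(ft)»; file 14 of the gen-23 programme). Inputs: the tree's
vertex-cutset bound `LaplacianVertexDeletion.algConn_le_of_induce_not_connected` (`G[s]`
disconnected ⇒ `μ₂(G) ≤ |V| − |s|`, Fiedler / Godsil–Royle Cor. 13.5.2) and Mathlib's trees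
(`SimpleGraph.IsTree`, every edge of a forest is a bridge). Theorems only.

## Source (held, read 2026-08-27): R. Merris, *Graph Theory*, Wiley (2000) [Merris2000], Ch. 9

* **Definition 9.22** "The algebraic connectivity of a graph `G` on `n` vertices is
  `a(G) = λ_{n−1}(G)`." and Eq. (66) (Fiedler) "`a(G) ≤ κ(G)`, provided `G ≠ K_n`."
* **Exercise 9** (p0155) "If `T` is a tree on `n ≥ 3` vertices, prove that `λ_{n−1}(T) ≤ 1`."

## What is here (def-free; `a(G) = μ₂ = hL.eigenvalues₀ ⟨n − 2, _⟩` as in the tree's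
`AlgebraicConnectivity`)

* `not_connected_induce_compl_singleton_of_isAcyclic` — in a forest, a vertex with two distinct
  neighbours is a cut vertex (`G − v` is disconnected): every edge of a forest is a bridge.
* **`algConn_le_one_of_isTree`** = EXERCISE 9.9: for a tree on `n ≥ 3` vertices `a(T) ≤ 1`
  (a tree on `≥ 3` vertices has a vertex of degree `≥ 2`, a cut vertex; then `a(T) ≤ κ(T) = 1`).

## References

* [Merris2000] R. Merris, *Graph Theory*, Wiley-Interscience (2000), Ch. 9 Def 9.22, Eq. (66),
  Exercise 9 (pp. 147, 155 of the held text).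
* [GodsilRoyle2001] C. Godsil, G. Royle, *Algebraic Graph Theory*, Springer (2001), Cor. 13.5.2
  (the vertex-cutset bound, through the tree's `LaplacianVertexDeletion`).
-/

open Matrix Finset
open Literature.Combinatorics.SimpleGraph.LaplacianVertexDeletion

namespace Literature.Combinatorics.SimpleGraph.TreeAlgebraicConnectivity

variable {V : Type*} [Fintype V] [DecidableEq V] (G : SimpleGraph V) [DecidableRel G.Adj]

omit [Fintype V] [DecidableEq V] [DecidableRel G.Adj] in
/-- **A vertex of a forest with two distinct neighbours is a cut vertex:** if `G` is acyclic and
`v ∼ u`, `v ∼ w`, `u ≠ w`, then `G − v = G.induce {v}ᶜ` is disconnected (a `u`–`w` path avoiding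
`v` together with the edges `wv`, `vu` would make the bridge `vu` superfluous).
[cite: Merris2000, Ch. 9 Exercise 9 (step: a tree on n ≥ 3 vertices has a cut vertex)] -/
theorem not_connected_induce_compl_singleton_of_isAcyclic (hG : G.IsAcyclic) {v u w : V}
    (hu : G.Adj v u) (hw : G.Adj v w) (huw : u ≠ w) :
    ¬ (G.induce ({v}ᶜ : Set V)).Connected := by
  intro hc
  have huv : u ≠ v := (G.ne_of_adj hu).symm
  have hwv : w ≠ v := (G.ne_of_adj hw).symm
  obtain ⟨p⟩ := hc.preconnected ⟨u, Set.mem_compl_singleton_iff.2 huv⟩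
    ⟨w, Set.mem_compl_singleton_iff.2 hwv⟩
  -- map the walk into `G` minus the edge `vu`
  let φ : (G.induce ({v}ᶜ : Set V)) →g (G.deleteEdges {s(v, u)}) :=
    { toFun := fun x => (x : V)
      map_rel' := fun {a b} hab => by
        rw [SimpleGraph.deleteEdges_adj]
        refine ⟨hab, ?_⟩
        rw [Set.mem_singleton_iff, Sym2.eq_iff]
        have ha := Set.mem_compl_singleton_iff.1 a.2
        have hb := Set.mem_compl_singleton_iff.1 b.2
        rintro (⟨hav, -⟩ | ⟨-, hbv⟩)
        · exact ha hav
        · exact hb hbv }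
  have hreach : (G.deleteEdges {s(v, u)}).Reachable u v := by
    refine ⟨(p.map φ).append (SimpleGraph.Walk.cons ?_ SimpleGraph.Walk.nil)⟩
    rw [SimpleGraph.deleteEdges_adj]
    refine ⟨hw.symm, ?_⟩
    rw [Set.mem_singleton_iff, Sym2.eq_iff]
    rintro (⟨hwv', -⟩ | ⟨hwu, -⟩)
    · exact hwv hwv'
    · exact huw.symm hwu
  have hbridge := SimpleGraph.isAcyclic_iff_forall_adj_isBridge.1 hG hu
  rw [SimpleGraph.isBridge_iff] at hbridge
  exact hbridge hreach.symm

/-- A tree on `n ≥ 3` vertices has a vertex with two distinct neighbours (`Σ d = 2(n − 1) > n`).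
[cite: Merris2000, Ch. 9 Exercise 9 (step)] -/
private theorem exists_adj_adj_ne_of_isTree (hT : G.IsTree) (hn : 3 ≤ Fintype.card V) :
    ∃ v u w, G.Adj v u ∧ G.Adj v w ∧ u ≠ w := by
  by_contra hc
  push Not at hc
  have hdeg : ∀ v, G.degree v ≤ 1 := by
    intro v
    by_contra h
    obtain ⟨u, hu, w, hw, huw⟩ := Finset.one_lt_card.1 (not_le.1 h)
    rw [SimpleGraph.mem_neighborFinset] at hu hw
    exact huw (hc v u w hu hw)
  have hsum := G.sum_degrees_eq_twice_card_edges
  have hE := hT.card_edgeFinset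
  have hle : ∑ v, G.degree v ≤ Fintype.card V := by
    calc ∑ v, G.degree v ≤ ∑ _v : V, 1 := Finset.sum_le_sum fun v _ => hdeg v
      _ = Fintype.card V := by simp
  omega

/-- **Merris 2000, Ch. 9 Exercise 9: "If `T` is a tree on `n ≥ 3` vertices, prove that
`λ_{n−1}(T) ≤ 1`"** — the algebraic connectivity `a(T) = λ_{n−1}(T)` (Def 9.22; Mathlib's sorted
`eigenvalues₀` at index `n − 2`) of a tree on at least three vertices is at most `1` (a vertex of
degree `≥ 2` is a cut vertex, and `a(G) ≤ κ(G)`, Eq. (66)). [cite: Merris2000, Ch. 9 Exercise 9] -/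
theorem algConn_le_one_of_isTree (hT : G.IsTree) (hn : 3 ≤ Fintype.card V)
    (hL : (G.lapMatrix ℝ).IsHermitian) :
    hL.eigenvalues₀ ⟨Fintype.card V - 2, by omega⟩ ≤ 1 := by
  obtain ⟨v, u, w, hu, hw, huw⟩ := exists_adj_adj_ne_of_isTree G hT hn
  have hc := not_connected_induce_compl_singleton_of_isAcyclic G hT.isAcyclic hu hw huw
  have hcard : Fintype.card (↥({v}ᶜ : Set V)) = Fintype.card V - 1 := by
    rw [Fintype.card_compl_set, Set.card_singleton]
  have h := algConn_le_of_induce_not_connected G ({v}ᶜ : Set V) (by omega) (by rw [hcard]; omega)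
    hL hc
  rw [hcard, Nat.cast_sub (by omega), Nat.cast_one] at h
  linarith

end Literature.Combinatorics.SimpleGraph.TreeAlgebraicConnectivity
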